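import Summits.Ventures.PercRepro.Night2LocalFourTwo

/-!
# PercRepro — corollaries of `shadowHall_four_two` (night-2, gen 7)

* **`hall_four_two`**: the per-flat Hall form C-029 at `(4, 2)` for every finite matroid (`hall_of_shadowHall`);
* **`shadowHallLevel_four_two`**: the level-wise shadow form at `(4, 2)`, level `3` (the only middle level at the
  diagonal — a rank-`3` set is the whole middle level, so `shadowLevel M 3 𝒜 = shadow M 4 2 𝒜`);
* **`shadowHall_four_two_sub`**: the sub-family reading spelled out — for every `𝒜 ⊆ Uq M 4 2`,
  `(4/3) · #𝒜 ≤ #shadow M 4 2 𝒜`.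
-/

open scoped Matroid

namespace PercRepro.Shadow

open Finset PerFlat ThmH

/-- **C-029 at `(4, 2)` for every finite matroid**: Hall's condition on the flat adjacency with constant `Φ(4,2)`. -/
theorem hall_four_two {α : Type} [DecidableEq α] (M : Matroid α) [M.Finite] : Hall M 4 2 (phiK 4 2) :=
  hall_of_shadowHall (shadowHall_four_two M)

/-- The sub-family reading of `shadowHall_four_two`: `(4/3)·#𝒜 ≤ #shadow 𝒜` for every `𝒜 ⊆ Uq M 4 2`. -/
theorem shadowHall_four_two_sub {α : Type} [DecidableEq α] (M : Matroid α) [M.Finite]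
    (𝒜 : Finset (Finset α)) (h𝒜 : 𝒜 ⊆ Uq M 4 2) :
    (4 / 3 : ℚ) * (𝒜.card : ℚ) ≤ ((shadow M 4 2 𝒜).card : ℚ) := by
  have h := shadowHall_four_two M 𝒜 h𝒜
  rw [GenQ.phiK_succ_succ 2] at h
  convert h using 2
  norm_num

end PercRepro.Shadow
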